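import Mathlib
import Literature.NumberTheory.LFunctions.Zhang2022.GaussKernelContour
import Literature.NumberTheory.LFunctions.Zhang2022.Section15CU055Residue
import Literature.NumberTheory.LFunctions.Zhang2022.Section15U056Rate
import Literature.NumberTheory.LFunctions.EulerMaclaurinZeta
import Literature.NumberTheory.LFunctions.DirichletLFunctionPolyaVinogradovBound
import Literature.NumberTheory.LFunctions.VinogradovKorobovFromRichert
import HarnessLib

/-!
# The contour shift of Zhang (2022) §15 p. 87 ("in the same way as in the proof of Lemma 8.4"):
# `(2πi)⁻¹∫_{(1)} ζ(1+s)²L(1+s−βⱼ,χ)²U(1+s)Tˢω₁(s)s⁻¹ds = Res_{s=0} + O(tiny·sup|U|)`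

Topic `Literature/NumberTheory/LFunctions/Zhang2022` (Landau–Siegel audit tree; verdict-neutral).
Y. Zhang, *Discrete mean estimates and the Landau–Siegel zero*, arXiv:2211.02515v1 (2022)
[Zhang2022LandauSiegel] — **an unrefereed manuscript under adjudication**; nothing here asserts or denies
its Theorems 1–2. Step §15 p. 87, tex L4359–L4361 («By Lemma 15.3, we can move the contour of integration
in the same way as in the proof of Lemma 8.4»), CONTOUR PART in the reading of record
`Typed.Section15C.Step15_u055RelS` (RT-07′): Landau's rectangle `[−1/10, 1] × [−H, H]`, `H = 𝓛¹⁶`, for the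
integrand `Φ(s)·Tˢω₁(s)/s`, `Φ(s) = ζ(1+s)²L(1+s−βⱼ,χ)²U(1+s)`, `ω₁ = ω₁(𝓛³⁰, ·)`, via the tree's engine
`GaussKernelContour.norm_lineIntegral_sub_residues_le` (p473527). Inputs, all TREE THEOREMS:
`‖ζ(s)‖ ≤ 1/|s−1| + ½ + |s|/12 + |s(s+1)(s+2)|/48` on `Re s ≥ −1` (`norm_riemannZeta_le_of_neg_one_le_re`,
Euler–Maclaurin), `|L(s,χ)| ≤ e^{3/2}(√q(1+log q))^{1−σ}(1+log q)|s|` on `½ ≤ σ ≤ 1`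
(`DirichletAbel.norm_LFunction_le_polyaVinogradov_of_half_le`), `|L(s,χ)| ≤ log q + log|t| + 5` on
`1 ≤ σ ≤ 2`, `|t| ≥ 3` (`VKFromRichert.norm_LFunction_le_log`), absolute convergence on `σ ≥ 2`, and the
pole datum `U055.pole_datum_triple`. The only datum about `U` used is a bound `‖U(s)‖ ≤ B` on
`Re s ≥ 9/10` and analyticity there (Lemma 15.3, RULING 15e).

* `norm_integral_sub_residue_le` — for all large `D`, under (A), `j ∈ {1,2,3}`: the distance between
  `(1/2π)∫_ℝ Φ(1+it)·T^{1+it}ω₁(1+it)/(1+it) dt` and the residue at the triple pole `s = 0` is at most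
  `B·α𝓛³` (indeed exponentially small: `≪ B·poly(𝓛)·(e^{𝓛^{1.1}−𝓛²/4} + D^{1/10}e^{−𝓛^{1.1}/10})`).

WHAT THIS IS NOT: the residue evaluation (`Section15CU055ResidueTerm`), the unsmoothing (u054), nor any
claim about Theorems 1–2 / Landau–Siegel zeros.

## References
* Y. Zhang, arXiv:2211.02515v1 (2022), §15 p. 87, tex L4354–L4361; §8 proof of Lemma 8.2 p. 44.
  [cite: Zhang2022LandauSiegel, §15 p.87]
* H. L. Montgomery, R. C. Vaughan, *Multiplicative Number Theory I*, CUP 2007, §6.2 (Landau's contour).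
  [cite: MontgomeryVaughan2007, §6.2]
-/

noncomputable section

open Complex Real Set Filter Topology Metric MeasureTheory

namespace Literature.NumberTheory.LFunctions.Zhang2022.U055

open Literature.NumberTheory.LFunctions.Zhang2022.Skeleton GaussWeight

/-! ### Bounds for `ζ` and `L(·,χ)` on the pieces of Landau's contour -/

section StripBounds

variable {q : ℕ} [NeZero q] (χ : DirichletCharacter ℂ q)

/-- `‖ζ(s)‖ ≤ Σ_{n≥1} n⁻²` for `Re s ≥ 2` (absolute convergence). [folklore] -/
private theorem norm_riemannZeta_le_Z2 {s : ℂ} (hs : 2 ≤ s.re) :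
    ‖riemannZeta s‖ ≤ ∑' n : ℕ, ‖LSeries.term (1 : ℕ → ℂ) 2 n‖ := by
  have hs1 : 1 < s.re := by linarith
  have hsum2 : Summable fun n : ℕ => ‖LSeries.term (1 : ℕ → ℂ) 2 n‖ :=
    (LSeriesSummable_one_iff.mpr (by norm_num : 1 < (2 : ℂ).re)).norm
  have hle : ∀ n, ‖LSeries.term (1 : ℕ → ℂ) s n‖ ≤ ‖LSeries.term (1 : ℕ → ℂ) 2 n‖ :=
    fun n => LSeries.norm_term_le_of_re_le_re 1 (by simpa using hs) n
  have hsums : Summable fun n : ℕ => ‖LSeries.term (1 : ℕ → ℂ) s n‖ :=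
    hsum2.of_nonneg_of_le (fun _ => norm_nonneg _) hle
  rw [← LSeries_one_eq_riemannZeta hs1, LSeries]
  exact (norm_tsum_le_tsum_norm hsums).trans (hsums.tsum_le_tsum hle hsum2)

/-- `‖L(s,χ)‖ ≤ Σ_{n≥1} n⁻²` for `Re s ≥ 2`. [folklore] -/
private theorem norm_LFunction_le_Z2 {s : ℂ} (hs : 2 ≤ s.re) :
    ‖χ.LFunction s‖ ≤ ∑' n : ℕ, ‖LSeries.term (1 : ℕ → ℂ) 2 n‖ := by
  have hs1 : 1 < s.re := by linarith
  have hsum2 : Summable fun n : ℕ => ‖LSeries.term (1 : ℕ → ℂ) 2 n‖ :=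
    (LSeriesSummable_one_iff.mpr (by norm_num : 1 < (2 : ℂ).re)).norm
  have hle : ∀ n, ‖LSeries.term (fun n => χ n) s n‖ ≤ ‖LSeries.term (1 : ℕ → ℂ) 2 n‖ := by
    intro n
    calc ‖LSeries.term (fun n => χ n) s n‖ ≤ ‖LSeries.term (1 : ℕ → ℂ) s n‖ :=
          LSeries.norm_term_le s (by simp only [Pi.one_apply, norm_one]; exact χ.norm_le_one _)
      _ ≤ ‖LSeries.term (1 : ℕ → ℂ) 2 n‖ := LSeries.norm_term_le_of_re_le_re 1 (by simpa using hs) n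
  have hsums : Summable fun n : ℕ => ‖LSeries.term (fun n => χ n) s n‖ :=
    hsum2.of_nonneg_of_le (fun _ => norm_nonneg _) hle
  rw [DirichletCharacter.LFunction_eq_LSeries χ hs1, LSeries]
  exact (norm_tsum_le_tsum_norm hsums).trans (hsums.tsum_le_tsum hle hsum2)

/-- `0 ≤ Σ_{n≥1} n⁻²`. [folklore] -/
private theorem Z2_nonneg : 0 ≤ ∑' n : ℕ, ‖LSeries.term (1 : ℕ → ℂ) 2 n‖ :=
  tsum_nonneg fun _ => norm_nonneg _

/-- `ζ` on the contour away from its pole: for `Re s ≥ −1`, `‖s‖ ≤ H + 2`, `‖s − 1‖ ≥ 1/10` (`H ≥ 1`),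
`‖ζ(s)‖ ≤ (H + 5)³` (the tree's Euler–Maclaurin bound). [folklore] -/
private theorem norm_riemannZeta_le_cube {s : ℂ} {H : ℝ} (hH : 1 ≤ H) (hre : -1 ≤ s.re)
    (hs : ‖s‖ ≤ H + 2) (hs1 : 1 / 10 ≤ ‖s - 1‖) : ‖riemannZeta s‖ ≤ (H + 5) ^ 3 := by
  have hne : s ≠ 1 := by
    intro h; rw [h, sub_self, norm_zero] at hs1; norm_num at hs1
  have h := Literature.NumberTheory.LFunctions.norm_riemannZeta_le_of_neg_one_le_re hre hne
  have h1 : 1 / ‖s - 1‖ ≤ 10 := by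
    rw [div_le_iff₀ (lt_of_lt_of_le (by norm_num) hs1)]; linarith
  have h2 : ‖s + 1‖ ≤ H + 3 := by
    calc ‖s + 1‖ ≤ ‖s‖ + ‖(1 : ℂ)‖ := norm_add_le _ _
      _ ≤ H + 2 + 1 := by rw [norm_one]; linarith
      _ = H + 3 := by ring
  have h3 : ‖s + 2‖ ≤ H + 4 := by
    calc ‖s + 2‖ ≤ ‖s‖ + ‖(2 : ℂ)‖ := norm_add_le _ _
      _ ≤ H + 2 + 2 := by rw [Complex.norm_two]; linarith
      _ = H + 4 := by ring
  have hs0 : 0 ≤ ‖s‖ := norm_nonneg _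
  calc ‖riemannZeta s‖ ≤ 1 / ‖s - 1‖ + 1 / 2 + ‖s‖ / 12 + ‖s‖ * ‖s + 1‖ * ‖s + 2‖ / 48 := h
    _ ≤ 10 + 1 / 2 + (H + 2) / 12 + (H + 2) * (H + 3) * (H + 4) / 48 := by
        gcongr
    _ ≤ (H + 5) ^ 3 := by
        have h0 : 0 ≤ H := by linarith
        have hA : (H + 2) / 12 ≤ H + 2 := by linarith
        have hB : (H + 2) * (H + 3) * (H + 4) / 48 ≤ (H + 2) * (H + 3) * (H + 4) := by
          have : 0 ≤ (H + 2) * (H + 3) * (H + 4) := by positivity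
          linarith
        have hC : (H + 5) ^ 3 = (H + 2) * (H + 3) * (H + 4) + (H + 2) + 11 + (6 * H ^ 2 + 48 * H + 88) := by
          ring
        nlinarith [sq_nonneg H]

/-- `L(s,χ)` (`χ` primitive mod `q ≥ 8`) for `9/10 ≤ Re s ≤ 1`:
`‖L(s,χ)‖ ≤ e^{3/2}(√q(1+log q))^{1/10}(1+log q)‖s‖`. [cite: MontgomeryVaughan2007, §9.4 Thm 9.18] -/
private theorem norm_LFunction_le_of_re_mem {s : ℂ} (hq : 8 ≤ q) (hχ : χ.IsPrimitive)
    (hs0 : 9 / 10 ≤ s.re) (hs1 : s.re ≤ 1) :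
    ‖χ.LFunction s‖ ≤
      Real.exp (3 / 2) * (Real.sqrt q * (1 + Real.log q)) ^ (1 / 10 : ℝ) * (1 + Real.log q) * ‖s‖ := by
  have h := Literature.NumberTheory.LFunctions.DirichletAbel.norm_LFunction_le_polyaVinogradov_of_half_le
    χ hq hχ (by linarith) hs1
  have hq1 : (1 : ℝ) ≤ q := by exact_mod_cast (le_trans (by norm_num) hq)
  have hlog : 0 ≤ Real.log q := Real.log_nonneg hq1
  have hbase : 1 ≤ Real.sqrt q * (1 + Real.log q) := by
    have : 1 ≤ Real.sqrt q := by rw [Real.one_le_sqrt]; exact hq1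
    nlinarith
  have hpow : (Real.sqrt q * (1 + Real.log q)) ^ (1 - s.re) ≤
      (Real.sqrt q * (1 + Real.log q)) ^ (1 / 10 : ℝ) :=
    Real.rpow_le_rpow_of_exponent_le hbase (by linarith)
  refine h.trans ?_
  gcongr

/-- `L(s,χ)` (`χ ≠ 1`) for `1 ≤ Re s ≤ 2`, `|Im s| ≥ 3`: `‖L(s,χ)‖ ≤ log q + |Im s| + 5`
(`log|t| ≤ |t|`). [cite: MontgomeryVaughan2007, §6.2] -/
private theorem norm_LFunction_le_of_one_le_re {s : ℂ} (hχ : χ ≠ 1) (h1 : 1 ≤ s.re) (h2 : s.re ≤ 2)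
    (ht : 3 ≤ |s.im|) : ‖χ.LFunction s‖ ≤ Real.log q + |s.im| + 5 := by
  have h := Literature.NumberTheory.LFunctions.VKFromRichert.norm_LFunction_le_log χ hχ h1 h2 ht
  have : Real.log |s.im| ≤ |s.im| := (Real.log_le_sub_one_of_pos (by linarith)).trans (by linarith)
  linarith

end StripBounds


/-! ### The prefactor `Φ(s) = ζ(1+s)²L(1+s−β,χ)²U(1+s)` on the contour -/

section PhiBounds

variable {D : ℕ} [NeZero D] (χ : DirichletCharacter ℂ D)

/-- Norm of a product `a²·(b²·c)` from bounds on the factors. [folklore] -/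
private theorem norm_sq_mul_sq_mul_le {a b c : ℂ} {A Bb C : ℝ} (ha : ‖a‖ ≤ A) (hb : ‖b‖ ≤ Bb)
    (hc : ‖c‖ ≤ C) : ‖a ^ 2 * (b ^ 2 * c)‖ ≤ A ^ 2 * (Bb ^ 2 * C) := by
  have hA : 0 ≤ A := (norm_nonneg _).trans ha
  have hB : 0 ≤ Bb := (norm_nonneg _).trans hb
  rw [norm_mul, norm_mul, norm_pow, norm_pow]
  gcongr

/-- **`Φ` on the line `Re s = 1`**: `‖Φ(1+it)‖ ≤ Z₂⁴·B` (`Z₂ = Σ n⁻²`; `Re β = 0`, `‖U‖ ≤ B` on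
`Re ≥ 9/10`). [cite: Zhang2022LandauSiegel, §15 p.87] -/
theorem norm_Phi_line_one_le {β : ℂ} (hβ : β.re = 0) {U : ℂ → ℂ} {B : ℝ}
    (hUB : ∀ s : ℂ, 9 / 10 ≤ s.re → ‖U s‖ ≤ B) (t : ℝ) :
    ‖riemannZeta (1 + (((1 : ℝ) : ℂ) + t * I)) ^ 2 *
        (χ.LFunction (1 + (((1 : ℝ) : ℂ) + t * I) - β) ^ 2 * U (1 + (((1 : ℝ) : ℂ) + t * I)))‖ ≤
      (∑' n : ℕ, ‖LSeries.term (1 : ℕ → ℂ) 2 n‖) ^ 2 *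
        ((∑' n : ℕ, ‖LSeries.term (1 : ℕ → ℂ) 2 n‖) ^ 2 * B) := by
  refine norm_sq_mul_sq_mul_le (norm_riemannZeta_le_Z2 (by simp; norm_num))
    (norm_LFunction_le_Z2 χ ?_) (hUB _ (by simp; norm_num))
  simp [hβ]; norm_num

/-- **`Φ` on the left segment `Re s = −1/10`, `|t| ≤ H`** (`H ≥ 4`, `D ≥ 8`, `χ` primitive, `Re β = 0`,
`|Im β| ≤ 1`): `‖Φ(−1/10+it)‖ ≤ (H+5)⁶·(Λ_D(H+2))²·B` with
`Λ_D = e^{3/2}(√D(1+𝓛))^{1/10}(1+𝓛)`. [cite: Zhang2022LandauSiegel, §15 p.87] -/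
theorem norm_Phi_left_le (hD8 : 8 ≤ D) (hp : χ.IsPrimitive) {β : ℂ} (hβ : β.re = 0) (hβi : |β.im| ≤ 1)
    {U : ℂ → ℂ} {B H : ℝ} (hH : 4 ≤ H) (hUB : ∀ s : ℂ, 9 / 10 ≤ s.re → ‖U s‖ ≤ B) {t : ℝ}
    (ht : |t| ≤ H) :
    ‖riemannZeta (1 + (((-1 / 10 : ℝ) : ℂ) + t * I)) ^ 2 *
        (χ.LFunction (1 + (((-1 / 10 : ℝ) : ℂ) + t * I) - β) ^ 2 *
          U (1 + (((-1 / 10 : ℝ) : ℂ) + t * I)))‖ ≤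
      ((H + 5) ^ 3) ^ 2 *
        ((Real.exp (3 / 2) * (Real.sqrt D * (1 + Real.log D)) ^ (1 / 10 : ℝ) * (1 + Real.log D) *
            (H + 2)) ^ 2 * B) := by
  set s : ℂ := 1 + (((-1 / 10 : ℝ) : ℂ) + t * I) with hs
  have hsre : s.re = 9 / 10 := by simp [hs]; norm_num
  have hsim : s.im = t := by simp [hs]
  have hζ : ‖riemannZeta s‖ ≤ (H + 5) ^ 3 := by
    refine norm_riemannZeta_le_cube (by linarith) (by rw [hsre]; norm_num) ?_ ?_
    · calc ‖s‖ ≤ |s.re| + |s.im| := Complex.norm_le_abs_re_add_abs_im s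
        _ ≤ H + 2 := by rw [hsre, hsim]; norm_num; linarith
    · have h := Complex.abs_re_le_norm (s - 1)
      have : (s - 1).re = -1 / 10 := by simp [hs]
      rw [this] at h; norm_num at h; exact h
  have hL : ‖χ.LFunction (s - β)‖ ≤ Real.exp (3 / 2) * (Real.sqrt D * (1 + Real.log D)) ^ (1 / 10 : ℝ) *
      (1 + Real.log D) * (H + 2) := by
    have h1 : (s - β).re = 9 / 10 := by simp [hsre, hβ]
    have h := norm_LFunction_le_of_re_mem χ hD8 hp (by rw [h1]) (by rw [h1]; norm_num)
    refine h.trans ?_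
    have hn : ‖s - β‖ ≤ H + 2 := by
      calc ‖s - β‖ ≤ |(s - β).re| + |(s - β).im| := Complex.norm_le_abs_re_add_abs_im _
        _ = 9 / 10 + |t - β.im| := by
            rw [h1, abs_of_nonneg (by norm_num : (0:ℝ) ≤ 9 / 10)]; simp [hsim]
        _ ≤ 9 / 10 + (|t| + |β.im|) := by gcongr; exact abs_sub _ _
        _ ≤ H + 2 := by linarith
    have h0 : 0 ≤ Real.exp (3 / 2) * (Real.sqrt D * (1 + Real.log D)) ^ (1 / 10 : ℝ) *
        (1 + Real.log D) := by
      have : 0 ≤ Real.log D := Real.log_natCast_nonneg D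
      positivity
    exact mul_le_mul_of_nonneg_left hn h0
  exact norm_sq_mul_sq_mul_le hζ hL (hUB s (by rw [hsre]))

/-- **`Φ` on the horizontal sides `Im s = ±H`, `−1/10 ≤ Re s ≤ 1`** (`H ≥ 4`, `D ≥ 8`, `χ` primitive,
`Re β = 0`, `|Im β| ≤ 1`): `‖Φ(u ± iH)‖ ≤ (H+5)⁶·(Λ_D(H+3) + 𝓛 + H + 6)²·B`.
[cite: Zhang2022LandauSiegel, §15 p.87] -/
theorem norm_Phi_horizontal_le (hD8 : 8 ≤ D) (hp : χ.IsPrimitive) {β : ℂ} (hβ : β.re = 0)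
    (hβi : |β.im| ≤ 1) {U : ℂ → ℂ} {B H : ℝ} (hH : 4 ≤ H) (hUB : ∀ s : ℂ, 9 / 10 ≤ s.re → ‖U s‖ ≤ B)
    {u : ℝ} (hu1 : -1 / 10 ≤ u) (hu2 : u ≤ 1) {h : ℝ} (hh : h = H ∨ h = -H) :
    ‖riemannZeta (1 + ((u : ℂ) + (h : ℂ) * I)) ^ 2 *
        (χ.LFunction (1 + ((u : ℂ) + (h : ℂ) * I) - β) ^ 2 * U (1 + ((u : ℂ) + (h : ℂ) * I)))‖ ≤
      ((H + 5) ^ 3) ^ 2 *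
        ((Real.exp (3 / 2) * (Real.sqrt D * (1 + Real.log D)) ^ (1 / 10 : ℝ) * (1 + Real.log D) *
              (H + 3) + Real.log D + H + 6) ^ 2 * B) := by
  have hD2 : 2 ≤ D := le_trans (by norm_num) hD8
  have hχ1 := Lemma31.ne_one_of_isPrimitive χ hD2 hp
  set s : ℂ := 1 + ((u : ℂ) + (h : ℂ) * I) with hs
  have hsre : s.re = 1 + u := by simp [hs]
  have hsim : s.im = h := by simp [hs]
  have habs : |h| = H := by
    rcases hh with rfl | rfl
    · exact abs_of_nonneg (by linarith)
    · rw [abs_neg]; exact abs_of_nonneg (by linarith)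
  have hζ : ‖riemannZeta s‖ ≤ (H + 5) ^ 3 := by
    refine norm_riemannZeta_le_cube (by linarith) (by rw [hsre]; linarith) ?_ ?_
    · calc ‖s‖ ≤ |s.re| + |s.im| := Complex.norm_le_abs_re_add_abs_im s
        _ ≤ 2 + H := by
            rw [hsre, hsim, habs]; gcongr; rw [abs_le]; constructor <;> linarith
        _ = H + 2 := by ring
    · have h1 := Complex.abs_im_le_norm (s - 1)
      have : (s - 1).im = h := by simp [hs]
      rw [this, habs] at h1; linarith
  have hlog : 0 ≤ Real.log D := Real.log_natCast_nonneg D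
  set LB : ℝ := Real.exp (3 / 2) * (Real.sqrt D * (1 + Real.log D)) ^ (1 / 10 : ℝ) * (1 + Real.log D)
    with hLB
  have hLB0 : 0 ≤ LB := by rw [hLB]; positivity
  have hL : ‖χ.LFunction (s - β)‖ ≤ LB * (H + 3) + Real.log D + H + 6 := by
    have hre' : (s - β).re = 1 + u := by simp [hsre, hβ]
    have him' : (s - β).im = h - β.im := by simp [hsim]
    by_cases hu : u ≤ 0
    · -- `9/10 ≤ Re ≤ 1`: the Pólya–Vinogradov bound
      have hb := norm_LFunction_le_of_re_mem χ hD8 hp (by rw [hre']; linarith) (by rw [hre']; linarith)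
      have hn : ‖s - β‖ ≤ H + 3 := by
        calc ‖s - β‖ ≤ |(s - β).re| + |(s - β).im| := Complex.norm_le_abs_re_add_abs_im _
          _ = |1 + u| + |h - β.im| := by rw [hre', him']
          _ ≤ 2 + (|h| + |β.im|) := by
              gcongr
              · rw [abs_le]; constructor <;> linarith
              · exact abs_sub _ _
          _ ≤ H + 3 := by rw [habs]; linarith
      calc ‖χ.LFunction (s - β)‖ ≤ LB * ‖s - β‖ := hb
        _ ≤ LB * (H + 3) := mul_le_mul_of_nonneg_left hn hLB0
        _ ≤ LB * (H + 3) + Real.log D + H + 6 := by linarith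
    · -- `1 ≤ Re ≤ 2`: the logarithmic bound
      push Not at hu
      have him3 : 3 ≤ |(s - β).im| := by
        rw [him']
        have : |h| - |β.im| ≤ |h - β.im| := abs_sub_abs_le_abs_sub _ _
        rw [habs] at this; linarith
      have hb := norm_LFunction_le_of_one_le_re χ hχ1 (by rw [hre']; linarith) (by rw [hre']; linarith) him3
      have him4 : |(s - β).im| ≤ H + 1 := by
        rw [him']
        calc |h - β.im| ≤ |h| + |β.im| := abs_sub _ _
          _ ≤ H + 1 := by rw [habs]; linarith
      have : 0 ≤ LB * (H + 3) := by positivity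
      change ‖χ.LFunction (s - β)‖ ≤ Real.log D + |(s - β).im| + 5 at hb
      linarith
  exact norm_sq_mul_sq_mul_le hζ hL (hUB s (by rw [hsre]; linarith))

end PhiBounds


/-! ### Landau's rectangle for `Φ(s)Tˢω₁(s)/s`: the engine applied -/

section Engine

variable {D : ℕ} [NeZero D] (χ : DirichletCharacter ℂ D)

/-- `Φ` is differentiable at `z` whenever `1 + z ≠ 1` and `U` is analytic at `1 + z` (`χ ≠ 1`).
[cite: Zhang2022LandauSiegel, §15 p.87] -/
private theorem differentiableAt_Phi (hχ1 : χ ≠ 1) (β : ℂ) {U : ℂ → ℂ} {z : ℂ} (hz : (1 : ℂ) + z ≠ 1)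
    (hUz : AnalyticAt ℂ U (1 + z)) :
    DifferentiableAt ℂ (fun s : ℂ => riemannZeta (1 + s) ^ 2 *
      (χ.LFunction (1 + s - β) ^ 2 * U (1 + s))) z := by
  have hL := DirichletCharacter.differentiable_LFunction hχ1
  have hζ : DifferentiableAt ℂ (fun w : ℂ => riemannZeta (1 + w)) z :=
    (differentiableAt_riemannZeta hz).comp z ((differentiableAt_const _).add differentiableAt_id)
  have hLz : DifferentiableAt ℂ (fun w : ℂ => χ.LFunction (1 + w - β)) z :=
    (hL _).comp z (((differentiableAt_const _).add differentiableAt_id).sub (differentiableAt_const _))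
  have hUz' : DifferentiableAt ℂ (fun w : ℂ => U (1 + w)) z :=
    hUz.differentiableAt.comp z ((differentiableAt_const _).add differentiableAt_id)
  exact (hζ.pow 2).mul ((hLz.pow 2).mul hUz')

/-- **The contour shift, raw form** (§15 p.87 via `GaussKernelContour.norm_lineIntegral_sub_residues_le`
on `[−1/10, 1] × [−𝓛¹⁶, 𝓛¹⁶]`, `Y = T`, `Λ = 𝓛³⁰`, kernel pole `β = 0` merged into the triple pole at
`s = 0`): for `D ≥ 8` with `𝓛 ≥ 10`, `χ` primitive, `Re β = 0`, `|Im β| ≤ 1`, `U` analytic on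
`{Re ≥ 9/10}` with `‖U‖ ≤ B` there, the distance between `(1/2π)∫_ℝ Φ(1+it)T^{1+it}ω₁(1+it)/(1+it)dt` and the
residue `((swap dslope 0)^[2] φ) 0` is at most the engine's three-piece bound with
`M₀ = Z₂⁴B`, `M₁ = (H+5)⁶(Λ_D(H+2))²B`, `M₂ = (H+5)⁶(Λ_D(H+3)+𝓛+H+6)²B`, `H = 𝓛¹⁶`.
[cite: Zhang2022LandauSiegel, §15 p.87] -/
theorem norm_integral_sub_residue_le_raw (hD8 : 8 ≤ D) (hp : χ.IsPrimitive) (hℓ : 10 ≤ ell D)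
    {β : ℂ} (hβ : β.re = 0) (hβi : |β.im| ≤ 1) {U : ℂ → ℂ}
    (hU : AnalyticOnNhd ℂ U {s : ℂ | 9 / 10 ≤ s.re}) {B : ℝ} (hB : 0 ≤ B)
    (hUB : ∀ s : ℂ, 9 / 10 ≤ s.re → ‖U s‖ ≤ B) :
    ‖(1 / (2 * π) : ℂ) * (∫ t : ℝ,
        (riemannZeta (1 + (((1 : ℝ) : ℂ) + t * I)) ^ 2 *
          (χ.LFunction (1 + (((1 : ℝ) : ℂ) + t * I) - β) ^ 2 * U (1 + (((1 : ℝ) : ℂ) + t * I)))) *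
        (((bigT D : ℝ) : ℂ) ^ (((1 : ℝ) : ℂ) + t * I) * omega1 (ell D ^ 30) (((1 : ℝ) : ℂ) + t * I) /
          (((1 : ℝ) : ℂ) + t * I))) -
      (Function.swap dslope (0 : ℂ))^[2]
        (fun z => riemannZeta₁ (1 + z) ^ 2 * (χ.LFunction (1 + z - β) ^ 2 * U (1 + z)) *
          (((bigT D : ℝ) : ℂ) ^ z * omega1 (ell D ^ 30) z)) 0‖ ≤
      1 / (2 * π) *
        (2 * ((∑' n : ℕ, ‖LSeries.term (1 : ℕ → ℂ) 2 n‖) ^ 2 *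
              ((∑' n : ℕ, ‖LSeries.term (1 : ℕ → ℂ) 2 n‖) ^ 2 * B) *
            (bigT D ^ (1 : ℝ) * rexp (1 ^ 2 / (4 * ell D ^ 30)) / |(1 : ℝ)|) *
            (gauss (4 * ell D ^ 30)⁻¹ (ell D ^ 16) * (Real.sqrt (4 * π * ell D ^ 30) / 2))) +
          ((ell D ^ 16 + 5) ^ 3) ^ 2 *
              ((Real.exp (3 / 2) * (Real.sqrt D * (1 + Real.log D)) ^ (1 / 10 : ℝ) *
                  (1 + Real.log D) * (ell D ^ 16 + 2)) ^ 2 * B) *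
            (bigT D ^ (-1 / 10 : ℝ) * rexp ((-1 / 10) ^ 2 / (4 * ell D ^ 30)) / |(-1 / 10 : ℝ)|) *
            Real.sqrt (4 * π * ell D ^ 30) +
          2 * ((1 - (-1 / 10 : ℝ)) *
            (((ell D ^ 16 + 5) ^ 3) ^ 2 *
                ((Real.exp (3 / 2) * (Real.sqrt D * (1 + Real.log D)) ^ (1 / 10 : ℝ) *
                      (1 + Real.log D) * (ell D ^ 16 + 3) + Real.log D + ell D ^ 16 + 6) ^ 2 * B) *
              (max (bigT D ^ (-1 / 10 : ℝ)) (bigT D ^ (1 : ℝ)) *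
                rexp (max ((-1 / 10 : ℝ) ^ 2) ((1 : ℝ) ^ 2) / (4 * ell D ^ 30)) *
                gauss (4 * ell D ^ 30)⁻¹ (ell D ^ 16) / ell D ^ 16)))) := by
  set Λ : ℝ := ell D ^ 30 with hΛdef
  set T : ℝ := bigT D with hTdef
  set H : ℝ := ell D ^ 16 with hHdef
  have hD2 : 2 ≤ D := le_trans (by norm_num) hD8
  have hχ1 := Lemma31.ne_one_of_isPrimitive χ hD2 hp
  have hℓ1 : 1 ≤ ell D := by linarith
  have hΛ : 0 < Λ := by positivity
  have hT : 0 < T := Real.exp_pos _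
  have hH4 : 4 ≤ H := by
    calc (4 : ℝ) ≤ 10 := by norm_num
      _ ≤ ell D := hℓ
      _ = ell D ^ 1 := (pow_one _).symm
      _ ≤ ell D ^ 16 := pow_le_pow_right₀ hℓ1 (by norm_num)
  -- the bounds `M₀, M₁, M₂`
  set Z2 : ℝ := ∑' n : ℕ, ‖LSeries.term (1 : ℕ → ℂ) 2 n‖ with hZ2
  set LB : ℝ := Real.exp (3 / 2) * (Real.sqrt D * (1 + Real.log D)) ^ (1 / 10 : ℝ) * (1 + Real.log D)
    with hLB
  have hlog : 0 ≤ Real.log D := Real.log_natCast_nonneg D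
  have hLB0 : 0 ≤ LB := by rw [hLB]; positivity
  set M₀ : ℝ := Z2 ^ 2 * (Z2 ^ 2 * B) with hM₀
  set M₁ : ℝ := ((H + 5) ^ 3) ^ 2 * ((LB * (H + 2)) ^ 2 * B) with hM₁
  set M₂ : ℝ := ((H + 5) ^ 3) ^ 2 * ((LB * (H + 3) + Real.log D + H + 6) ^ 2 * B) with hM₂
  have hM₀0 : 0 ≤ M₀ := by positivity
  have hM₁0 : 0 ≤ M₁ := by positivity
  have hM₂0 : 0 ≤ M₂ := by positivity
  -- the prefactor `Φ`
  set Φ : ℂ → ℂ := fun s => riemannZeta (1 + s) ^ 2 * (χ.LFunction (1 + s - β) ^ 2 * U (1 + s)) with hΦ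
  have hΦ₀ : ∀ t : ℝ, ‖Φ (((1 : ℝ) : ℂ) + t * I)‖ ≤ M₀ := fun t => norm_Phi_line_one_le χ hβ hUB t
  have hΦ₁ : ∀ t : ℝ, |t| ≤ H → ‖Φ (((-1 / 10 : ℝ) : ℂ) + t * I)‖ ≤ M₁ := fun t ht =>
    norm_Phi_left_le χ hD8 hp hβ hβi hH4 hUB ht
  have hΦ₂ : ∀ u : ℝ, -1 / 10 ≤ u → u ≤ 1 →
      ‖Φ ((u : ℂ) + (H : ℂ) * I)‖ ≤ M₂ ∧ ‖Φ ((u : ℂ) + ((-H : ℝ) : ℂ) * I)‖ ≤ M₂ := fun u hu1 hu2 =>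
    ⟨norm_Phi_horizontal_le χ hD8 hp hβ hβi hH4 hUB hu1 hu2 (Or.inl rfl),
      norm_Phi_horizontal_le χ hD8 hp hβ hβi hH4 hUB hu1 hu2 (Or.inr rfl)⟩
  -- continuity on the line `Re s = 1` and integrability
  have hcont : Continuous fun t : ℝ => Φ (((1 : ℝ) : ℂ) + t * I) := by
    refine continuous_iff_continuousAt.2 fun t => ?_
    have hline : Continuous fun t : ℝ => (((1 : ℝ) : ℂ) + t * I) := by fun_prop
    have hz : (1 : ℂ) + (((1 : ℝ) : ℂ) + t * I) ≠ 1 := by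
      intro h; have := congrArg Complex.re h; simp at this
    have hUz : AnalyticAt ℂ U (1 + (((1 : ℝ) : ℂ) + t * I)) := hU _ (by simp; norm_num)
    have hc := ContinuousAt.comp (f := fun t : ℝ => (((1 : ℝ) : ℂ) + t * I))
      (differentiableAt_Phi χ hχ1 β hz hUz).continuousAt hline.continuousAt
    exact hc
  have hint := GaussKernelContour.integrable_line (Φ := Φ) (β := 0) (Y := T) hΛ hT (σ := 1)
    (by simp) hcont hΦ₀
  -- open set, rectangle, poles
  set Uo : Set ℂ := {z : ℂ | AnalyticAt ℂ U (1 + z)} with hUo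
  have hUo_open : IsOpen Uo := by
    have hc : Continuous fun z : ℂ => 1 + z := by fun_prop
    exact (isOpen_analyticAt ℂ U).preimage hc
  have hrect : Icc (-1 / 10 : ℝ) 1 ×ℂ Icc (-H) H ⊆ Uo := by
    intro z hz
    rw [mem_reProdIm] at hz
    refine hU _ ?_
    simp only [Set.mem_setOf_eq, Complex.add_re, Complex.one_re]
    linarith [hz.1.1]
  have hS : (({0} : Finset ℂ) : Set ℂ) ⊆ Ioo (-1 / 10 : ℝ) 1 ×ℂ Ioo (-H) H := by
    intro z hz
    simp only [Finset.coe_singleton, Set.mem_singleton_iff] at hz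
    rw [hz, mem_reProdIm]
    simp only [Complex.zero_re, Complex.zero_im, Set.mem_Ioo]
    refine ⟨⟨by norm_num, by norm_num⟩, ?_, ?_⟩ <;> linarith
  have hΦd : DifferentiableOn ℂ Φ (Uo \ (({0} : Finset ℂ) : Set ℂ)) := by
    intro z hz
    rw [Finset.coe_singleton, Set.mem_sdiff, Set.mem_singleton_iff] at hz
    have h1 : (1 : ℂ) + z ≠ 1 := by intro h; apply hz.2; linear_combination h
    exact (differentiableAt_Phi χ hχ1 β h1 hz.1).differentiableWithinAt
  have hG := GaussKernelContour.differentiableOn_mul_kernel_sdiff (Φ := Φ) (β := 0) hT Λ (by simp) hΦd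
  have hball : ball (0 : ℂ) (1 / 10) ∈ 𝓝 (0 : ℂ) := ball_mem_nhds 0 (by norm_num)
  have hL := DirichletCharacter.differentiable_LFunction hχ1
  have hg : DifferentiableOn ℂ (fun z : ℂ => χ.LFunction (1 + z - β) ^ 2 * U (1 + z))
      (ball (0 : ℂ) (1 / 10)) := by
    intro z hz
    have hre : 9 / 10 ≤ (1 + z).re := by
      rw [mem_ball_zero_iff] at hz
      have := Complex.abs_re_le_norm z
      have := neg_abs_le z.re
      simp only [Complex.add_re, Complex.one_re]; linarith
    have hLz : DifferentiableAt ℂ (fun w : ℂ => χ.LFunction (1 + w - β)) z :=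
      (hL _).comp z (((differentiableAt_const _).add differentiableAt_id).sub (differentiableAt_const _))
    have hUz : DifferentiableAt ℂ (fun w : ℂ => U (1 + w)) z :=
      (hU _ hre).differentiableAt.comp z ((differentiableAt_const _).add differentiableAt_id)
    exact ((hLz.pow 2).mul hUz).differentiableWithinAt
  obtain ⟨V', hV', hφd, hid⟩ := pole_datum_triple hball hg Λ hT
  have hpole : ∀ p ∈ ({0} : Finset ℂ), ∃ V ∈ 𝓝 p, DifferentiableOn ℂ
      ((fun _ : ℂ => fun z : ℂ => riemannZeta₁ (1 + z) ^ 2 *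
        (χ.LFunction (1 + z - β) ^ 2 * U (1 + z)) * (((T : ℝ) : ℂ) ^ z * omega1 Λ z)) p) V ∧
      ∀ z ∈ V, z ≠ p → Φ z * (((T : ℝ) : ℂ) ^ (z + 0) * omega1 Λ (z + 0) / (z + 0)) =
        (fun _ : ℂ => fun z : ℂ => riemannZeta₁ (1 + z) ^ 2 *
          (χ.LFunction (1 + z - β) ^ 2 * U (1 + z)) * (((T : ℝ) : ℂ) ^ z * omega1 Λ z)) p z /
          (z - p) ^ ((fun _ : ℂ => 2) p + 1) := by
    intro p hp
    rw [Finset.mem_singleton] at hp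
    subst hp
    refine ⟨V', hV', hφd, fun z hz hz0 => ?_⟩
    simp only [add_zero]
    have := hid z hz hz0
    simpa only [hΦ, mul_assoc] using this
  have h := GaussKernelContour.norm_lineIntegral_sub_residues_le (Φ := Φ) (β := 0) (Λ := Λ) (Y := T)
    (a := -1 / 10) (σ₀ := 1) (H := H) hΛ hT (by norm_num) (by simp; positivity) (by simp) (by simp)
    hM₀0 hM₁0 hM₂0 (fun t _ => hΦ₀ t) hΦ₁ hΦ₂ hint {0} (fun _ => 2) _ Uo hUo_open hrect hS hG hpole
  simp only [Complex.zero_re, Complex.zero_im, add_zero, abs_zero, sub_zero, Finset.sum_singleton] at h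
  exact h

end Engine


/-! ### Absorption: the three pieces are `≤ B·α𝓛³` for `𝓛` large (pure real analysis in `L = 𝓛`) -/

section Absorb

/-- The tenth root `u = L^{1/10}`: for `L ≥ 1024`, `2 ≤ u`, `u^10 = L`, `L^{1.1} = L·u`,
`log L ≤ 10u`, `512·u ≤ L`. [folklore] -/
private theorem tenth_root {L : ℝ} (hL : 1024 ≤ L) :
    2 ≤ L ^ (1 / 10 : ℝ) ∧ (L ^ (1 / 10 : ℝ)) ^ 10 = L ∧ L ^ (1.1 : ℝ) = L * L ^ (1 / 10 : ℝ) ∧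
      Real.log L ≤ 10 * L ^ (1 / 10 : ℝ) ∧ 512 * L ^ (1 / 10 : ℝ) ≤ L := by
  have hL0 : 0 < L := by linarith
  set u := L ^ (1 / 10 : ℝ) with hu
  have hu0 : 0 ≤ u := Real.rpow_nonneg hL0.le _
  have hu10 : u ^ 10 = L := by
    rw [hu, ← Real.rpow_natCast, ← Real.rpow_mul hL0.le]; norm_num
  have hu2 : 2 ≤ u := by
    by_contra h
    push Not at h
    have : u ^ 10 < 2 ^ 10 := pow_lt_pow_left₀ h hu0 (by norm_num)
    rw [hu10] at this; norm_num at this; linarith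
  have h11 : L ^ (1.1 : ℝ) = L * u := by
    rw [hu, show (1.1 : ℝ) = 1 + 1 / 10 by norm_num, Real.rpow_add hL0, Real.rpow_one]
  have hlog : Real.log L ≤ 10 * u := by
    have h := Real.log_le_rpow_div hL0.le (by norm_num : (0 : ℝ) < 1 / 10)
    rw [← hu] at h
    calc Real.log L ≤ u / (1 / 10) := h
      _ = 10 * u := by ring
  have h512 : 512 * u ≤ L := by
    have : 2 ^ 9 * u ≤ u ^ 9 * u := by
      apply mul_le_mul_of_nonneg_right _ hu0
      exact pow_le_pow_left₀ (by norm_num) hu2 9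
    calc 512 * u = 2 ^ 9 * u := by norm_num
      _ ≤ u ^ 9 * u := this
      _ = u ^ 10 := by ring
      _ = L := hu10
  exact ⟨hu2, hu10, h11, hlog, h512⟩

/-- `L^k ≤ exp(10 k u)` (`log L ≤ 10u`). [folklore] -/
private theorem pow_le_exp_mul {L u : ℝ} (hL : 0 < L) (hlog : Real.log L ≤ 10 * u) (k : ℕ) :
    L ^ k ≤ Real.exp (10 * k * u) := by
  have : L ^ k = Real.exp (k * Real.log L) := by
    rw [← Real.exp_log hL, ← Real.exp_nat_mul, Real.exp_log hL]
  rw [this]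
  exact Real.exp_le_exp.mpr (by nlinarith [Nat.cast_nonneg (α := ℝ) k])

/-- (C2): `4·10⁷ · L¹⁵³ · exp((L − L^{1.1})/10) ≤ 1` for `L ≥ 31000`. [folklore] -/
private theorem absorb_C2 {L : ℝ} (hL : 31000 ≤ L) :
    4e7 * L ^ 153 * Real.exp ((L - L ^ (1.1 : ℝ)) / 10) ≤ 1 := by
  have hL0 : 0 < L := by linarith
  obtain ⟨hu2, -, h11, hlog, -⟩ := tenth_root (by linarith : (1024 : ℝ) ≤ L)
  set u := L ^ (1 / 10 : ℝ)
  have hp := pow_le_exp_mul hL0 hlog 153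
  have hc : (4e7 : ℝ) ≤ Real.exp 18 := by
    have := Real.add_one_le_exp (18 : ℝ)
    -- crude: e^18 ≥ (1+18)… too weak; use e ≥ 2.7: e^18 ≥ 2.7^18
    have h1 : (2.7 : ℝ) ≤ Real.exp 1 := by
      have := Real.exp_one_gt_d9; linarith
    have h2 : (2.7 : ℝ) ^ 18 ≤ Real.exp 1 ^ 18 := pow_le_pow_left₀ (by norm_num) h1 18
    rw [← Real.exp_nat_mul] at h2
    norm_num at h2
    have h3 : (4e7 : ℝ) ≤ (2.7 : ℝ) ^ 18 := by norm_num
    linarith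
  calc 4e7 * L ^ 153 * Real.exp ((L - L ^ (1.1 : ℝ)) / 10)
      ≤ Real.exp 18 * Real.exp (10 * (153 : ℕ) * u) * Real.exp ((L - L ^ (1.1 : ℝ)) / 10) := by
        gcongr
    _ = Real.exp (18 + 1530 * u + (L - L * u) / 10) := by
        rw [← Real.exp_add, ← Real.exp_add, h11]; congr 1; push_cast; ring
    _ ≤ Real.exp 0 := by
        apply Real.exp_le_exp.mpr
        -- `18 ≤ 9u`, `(L − Lu)/10 ≤ −Lu/20` (u ≥ 2), `1539u ≤ Lu/20` (L ≥ 30780)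
        have h1 : (L - L * u) / 10 ≤ -(L * u) / 20 := by nlinarith
        have h2 : 18 ≤ 9 * u := by linarith
        have h3 : 1539 * u ≤ L * u / 20 := by nlinarith
        nlinarith
    _ = 1 := Real.exp_zero


/-- (C1): `L²² · exp(L^{1.1} − L²/4) ≤ 1` for `L ≥ 31000`. [folklore] -/
private theorem absorb_C1 {L : ℝ} (hL : 31000 ≤ L) :
    L ^ 22 * Real.exp (L ^ (1.1 : ℝ) - L ^ 2 / 4) ≤ 1 := by
  have hL0 : 0 < L := by linarith
  obtain ⟨hu2, -, h11, hlog, h512⟩ := tenth_root (by linarith : (1024 : ℝ) ≤ L)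
  set u := L ^ (1 / 10 : ℝ)
  have hp := pow_le_exp_mul hL0 hlog 22
  calc L ^ 22 * Real.exp (L ^ (1.1 : ℝ) - L ^ 2 / 4)
      ≤ Real.exp (10 * (22 : ℕ) * u) * Real.exp (L ^ (1.1 : ℝ) - L ^ 2 / 4) := by gcongr
    _ = Real.exp (220 * u + L * u - L ^ 2 / 4) := by
        rw [← Real.exp_add, h11]; congr 1; push_cast; ring
    _ ≤ Real.exp 0 := by
        apply Real.exp_le_exp.mpr
        have h1 : L * u ≤ L ^ 2 / 512 := by nlinarith
        have h2 : 220 * u ≤ L / 2 := by linarith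
        nlinarith
    _ = 1 := Real.exp_zero

/-- (C3): `3·10⁶ · L¹³⁸ · exp(L/10 + L^{1.1} − L²/4) ≤ 1` for `L ≥ 31000`. [folklore] -/
private theorem absorb_C3 {L : ℝ} (hL : 31000 ≤ L) :
    3e6 * L ^ 138 * Real.exp (L / 10 + L ^ (1.1 : ℝ) - L ^ 2 / 4) ≤ 1 := by
  have hL0 : 0 < L := by linarith
  obtain ⟨hu2, -, h11, hlog, h512⟩ := tenth_root (by linarith : (1024 : ℝ) ≤ L)
  set u := L ^ (1 / 10 : ℝ)
  have hp := pow_le_exp_mul hL0 hlog 138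
  have hc : (3e6 : ℝ) ≤ Real.exp 16 := by
    have h1 : (2.7 : ℝ) ≤ Real.exp 1 := by
      have := Real.exp_one_gt_d9; linarith
    have h2 : (2.7 : ℝ) ^ 16 ≤ Real.exp 1 ^ 16 := pow_le_pow_left₀ (by norm_num) h1 16
    rw [← Real.exp_nat_mul] at h2
    norm_num at h2
    have h3 : (3e6 : ℝ) ≤ (2.7 : ℝ) ^ 16 := by norm_num
    linarith
  calc 3e6 * L ^ 138 * Real.exp (L / 10 + L ^ (1.1 : ℝ) - L ^ 2 / 4)
      ≤ Real.exp 16 * Real.exp (10 * (138 : ℕ) * u) * Real.exp (L / 10 + L ^ (1.1 : ℝ) - L ^ 2 / 4) := by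
        gcongr
    _ = Real.exp (16 + 1380 * u + L / 10 + L * u - L ^ 2 / 4) := by
        rw [← Real.exp_add, ← Real.exp_add, h11]; congr 1; push_cast; ring
    _ ≤ Real.exp 0 := by
        apply Real.exp_le_exp.mpr
        have h1 : L * u ≤ L ^ 2 / 512 := by nlinarith
        have h2 : 16 ≤ 8 * u := by linarith
        have h3 : 1388 * u ≤ 3 * L := by linarith
        nlinarith
    _ = 1 := Real.exp_zero

/-- Elementary sizes for `L ≥ 31000`: `e^{3/2} ≤ 8`, the factor `Λ_D ≤ 32L²e^{L/20}`, and the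
polynomial pieces of `M₁, M₂`. [folklore] -/
private theorem poly_pieces {L : ℝ} (hL : 31000 ≤ L) :
    Real.exp (3 / 2) * (Real.exp (L / 2) * (1 + L)) ^ (1 / 10 : ℝ) * (1 + L) * (L ^ 16 + 2) ≤
        64 * L ^ 18 * Real.exp (L / 20) ∧
      Real.exp (3 / 2) * (Real.exp (L / 2) * (1 + L)) ^ (1 / 10 : ℝ) * (1 + L) * (L ^ 16 + 3) + L +
          L ^ 16 + 6 ≤ 72 * L ^ 18 * Real.exp (L / 20) ∧
      L ^ 16 + 5 ≤ 2 * L ^ 16 := by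
  have hL0 : 0 < L := by linarith
  have hL1 : 1 ≤ L := by linarith
  have e7 : (Real.exp (L / 2) * (1 + L)) ^ (1 / 10 : ℝ) ≤ Real.exp (L / 20) * (1 + L) := by
    rw [Real.mul_rpow (Real.exp_pos _).le (by linarith), ← Real.exp_mul]
    have h1 : (1 + L) ^ (1 / 10 : ℝ) ≤ (1 + L) ^ (1 : ℝ) :=
      Real.rpow_le_rpow_of_exponent_le (by linarith) (by norm_num)
    rw [Real.rpow_one] at h1
    have h2 : Real.exp (L / 2 * (1 / 10)) = Real.exp (L / 20) := by congr 1; ring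
    rw [h2]
    exact mul_le_mul_of_nonneg_left h1 (Real.exp_pos _).le
  have e8 : Real.exp (3 / 2) ≤ 8 := by
    have h1 : Real.exp (3 / 2) ≤ Real.exp 1 ^ 2 := by
      rw [← Real.exp_nat_mul]; exact Real.exp_le_exp.mpr (by norm_num)
    have h2 : Real.exp 1 ^ 2 ≤ (2.7182818286 : ℝ) ^ 2 :=
      pow_le_pow_left₀ (Real.exp_pos 1).le Real.exp_one_lt_d9.le 2
    nlinarith
  set LB : ℝ := Real.exp (3 / 2) * (Real.exp (L / 2) * (1 + L)) ^ (1 / 10 : ℝ) * (1 + L) with hLBdef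
  have hLB : LB ≤ 32 * L ^ 2 * Real.exp (L / 20) := by
    calc LB ≤ 8 * (Real.exp (L / 20) * (1 + L)) * (1 + L) := by
          rw [hLBdef]; gcongr
      _ = 8 * (1 + L) ^ 2 * Real.exp (L / 20) := by ring
      _ ≤ 8 * (2 * L) ^ 2 * Real.exp (L / 20) := by gcongr; linarith
      _ = 32 * L ^ 2 * Real.exp (L / 20) := by ring
  have hL16 : L ≤ L ^ 16 := by
    calc L = L ^ 1 := (pow_one L).symm
      _ ≤ L ^ 16 := pow_le_pow_right₀ hL1 (by norm_num)
  have hL18 : L ^ 16 ≤ L ^ 18 := pow_le_pow_right₀ hL1 (by norm_num)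
  have he : 1 ≤ Real.exp (L / 20) := Real.one_le_exp (by positivity)
  refine ⟨?_, ?_, by linarith⟩
  · calc LB * (L ^ 16 + 2) ≤ (32 * L ^ 2 * Real.exp (L / 20)) * (2 * L ^ 16) := by
          gcongr; linarith
      _ = 64 * L ^ 18 * Real.exp (L / 20) := by ring
  · have h1 : LB * (L ^ 16 + 3) ≤ (32 * L ^ 2 * Real.exp (L / 20)) * (2 * L ^ 16) := by
      gcongr; linarith
    have h2 : L + L ^ 16 + 6 ≤ 8 * L ^ 18 * Real.exp (L / 20) := by
      have h6 : L + L ^ 16 + 6 ≤ 8 * L ^ 18 := by nlinarith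
      calc L + L ^ 16 + 6 ≤ 8 * L ^ 18 := h6
        _ = 8 * L ^ 18 * 1 := (mul_one _).symm
        _ ≤ 8 * L ^ 18 * Real.exp (L / 20) := by gcongr
    nlinarith

/-- Piece 1 (the tails): `12Z⁴·B·L¹⁵·e^{L^{1.1}−L²/4} ≤ B/L⁶`. [folklore] -/
private theorem piece1_le {L B Z : ℝ} (hL : 31000 ≤ L) (hZL : 12 * Z ^ 4 ≤ L) (hB : 0 ≤ B) :
    2 * (Z ^ 2 * (Z ^ 2 * B) * (Real.exp (L ^ (1.1 : ℝ)) * 3 / 1) *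
        (Real.exp (-(L ^ 2 / 4)) * (4 * L ^ 15 / 2))) ≤ B / L ^ 6 := by
  have hL0 : 0 < L := by linarith
  have hL6 : 0 < L ^ 6 := by positivity
  have hC1 := absorb_C1 hL
  have hexp1 : Real.exp (L ^ (1.1 : ℝ)) * Real.exp (-(L ^ 2 / 4)) = Real.exp (L ^ (1.1 : ℝ) - L ^ 2 / 4) := by
    rw [← Real.exp_add]; ring_nf
  have e : 2 * (Z ^ 2 * (Z ^ 2 * B) * (Real.exp (L ^ (1.1 : ℝ)) * 3 / 1) *
      (Real.exp (-(L ^ 2 / 4)) * (4 * L ^ 15 / 2))) =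
      B * ((12 * Z ^ 4) * L ^ 15 * (Real.exp (L ^ (1.1 : ℝ)) * Real.exp (-(L ^ 2 / 4)))) := by ring
  rw [e, hexp1]
  have h1 : (12 * Z ^ 4) * L ^ 15 * Real.exp (L ^ (1.1 : ℝ) - L ^ 2 / 4) ≤ 1 / L ^ 6 := by
    rw [le_div_iff₀ hL6]
    calc 12 * Z ^ 4 * L ^ 15 * Real.exp (L ^ (1.1 : ℝ) - L ^ 2 / 4) * L ^ 6
        = (12 * Z ^ 4) * (L ^ 21 * Real.exp (L ^ (1.1 : ℝ) - L ^ 2 / 4)) := by ring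
      _ ≤ L * (L ^ 21 * Real.exp (L ^ (1.1 : ℝ) - L ^ 2 / 4)) := by gcongr
      _ = L ^ 22 * Real.exp (L ^ (1.1 : ℝ) - L ^ 2 / 4) := by ring
      _ ≤ 1 := hC1
  calc B * (12 * Z ^ 4 * L ^ 15 * Real.exp (L ^ (1.1 : ℝ) - L ^ 2 / 4)) ≤ B * (1 / L ^ 6) :=
        mul_le_mul_of_nonneg_left h1 hB
    _ = B / L ^ 6 := by ring

/-- Piece 2 (the left segment): `≤ B/L⁶`. [folklore] -/
private theorem piece2_le {L B : ℝ} (hL : 31000 ≤ L) (hB : 0 ≤ B) :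
    ((2 * L ^ 16) ^ 3) ^ 2 * ((64 * L ^ 18 * Real.exp (L / 20)) ^ 2 * B) *
        (Real.exp (-(L ^ (1.1 : ℝ)) / 10) * 3 / (1 / 10)) * (4 * L ^ 15) ≤ B / L ^ 6 := by
  have hL0 : 0 < L := by linarith
  have hL6 : 0 < L ^ 6 := by positivity
  have hC2 := absorb_C2 hL
  have hexp2 : Real.exp (L / 20) ^ 2 * Real.exp (-(L ^ (1.1 : ℝ)) / 10) =
      Real.exp ((L - L ^ (1.1 : ℝ)) / 10) := by
    rw [← Real.exp_nat_mul, ← Real.exp_add]; congr 1; push_cast; ring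
  have e : ((2 * L ^ 16) ^ 3) ^ 2 * ((64 * L ^ 18 * Real.exp (L / 20)) ^ 2 * B) *
      (Real.exp (-(L ^ (1.1 : ℝ)) / 10) * 3 / (1 / 10)) * (4 * L ^ 15) =
      B * (31457280 * L ^ 147 * (Real.exp (L / 20) ^ 2 * Real.exp (-(L ^ (1.1 : ℝ)) / 10))) := by ring
  rw [e, hexp2]
  have h1 : 31457280 * L ^ 147 * Real.exp ((L - L ^ (1.1 : ℝ)) / 10) ≤ 1 / L ^ 6 := by
    rw [le_div_iff₀ hL6]
    calc 31457280 * L ^ 147 * Real.exp ((L - L ^ (1.1 : ℝ)) / 10) * L ^ 6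
        = 31457280 * (L ^ 153 * Real.exp ((L - L ^ (1.1 : ℝ)) / 10)) := by ring
      _ ≤ 4e7 * (L ^ 153 * Real.exp ((L - L ^ (1.1 : ℝ)) / 10)) := by gcongr; norm_num
      _ = 4e7 * L ^ 153 * Real.exp ((L - L ^ (1.1 : ℝ)) / 10) := by ring
      _ ≤ 1 := hC2
  calc B * (31457280 * L ^ 147 * Real.exp ((L - L ^ (1.1 : ℝ)) / 10)) ≤ B * (1 / L ^ 6) :=
        mul_le_mul_of_nonneg_left h1 hB
    _ = B / L ^ 6 := by ring

/-- Piece 3 (the horizontal sides): `≤ B/L⁶`. [folklore] -/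
private theorem piece3_le {L B : ℝ} (hL : 31000 ≤ L) (hB : 0 ≤ B) :
    2 * ((1 - (-1 / 10 : ℝ)) *
        (((2 * L ^ 16) ^ 3) ^ 2 * ((72 * L ^ 18 * Real.exp (L / 20)) ^ 2 * B) *
          (Real.exp (L ^ (1.1 : ℝ)) * 3 * Real.exp (-(L ^ 2 / 4)) / 1))) ≤ B / L ^ 6 := by
  have hL0 : 0 < L := by linarith
  have hL6 : 0 < L ^ 6 := by positivity
  have hC3 := absorb_C3 hL
  have hexp3 : Real.exp (L / 20) ^ 2 * (Real.exp (L ^ (1.1 : ℝ)) * Real.exp (-(L ^ 2 / 4))) =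
      Real.exp (L / 10 + L ^ (1.1 : ℝ) - L ^ 2 / 4) := by
    rw [← Real.exp_nat_mul, ← Real.exp_add, ← Real.exp_add]; congr 1; push_cast; ring
  have e : 2 * ((1 - (-1 / 10 : ℝ)) *
      (((2 * L ^ 16) ^ 3) ^ 2 * ((72 * L ^ 18 * Real.exp (L / 20)) ^ 2 * B) *
        (Real.exp (L ^ (1.1 : ℝ)) * 3 * Real.exp (-(L ^ 2 / 4)) / 1))) =
      B * ((10948608 / 5) * L ^ 132 *
        (Real.exp (L / 20) ^ 2 * (Real.exp (L ^ (1.1 : ℝ)) * Real.exp (-(L ^ 2 / 4))))) := by ring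
  rw [e, hexp3]
  have h1 : (10948608 / 5) * L ^ 132 * Real.exp (L / 10 + L ^ (1.1 : ℝ) - L ^ 2 / 4) ≤ 1 / L ^ 6 := by
    rw [le_div_iff₀ hL6]
    calc (10948608 / 5) * L ^ 132 * Real.exp (L / 10 + L ^ (1.1 : ℝ) - L ^ 2 / 4) * L ^ 6
        = (10948608 / 5) * (L ^ 138 * Real.exp (L / 10 + L ^ (1.1 : ℝ) - L ^ 2 / 4)) := by ring
      _ ≤ 3e6 * (L ^ 138 * Real.exp (L / 10 + L ^ (1.1 : ℝ) - L ^ 2 / 4)) := by gcongr; norm_num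
      _ = 3e6 * L ^ 138 * Real.exp (L / 10 + L ^ (1.1 : ℝ) - L ^ 2 / 4) := by ring
      _ ≤ 1 := hC3
  calc B * ((10948608 / 5) * L ^ 132 * Real.exp (L / 10 + L ^ (1.1 : ℝ) - L ^ 2 / 4)) ≤
        B * (1 / L ^ 6) := mul_le_mul_of_nonneg_left h1 hB
    _ = B / L ^ 6 := by ring

/-- The raw three-piece bound, as a function of `L = log D`, is `≤ B·π·L⁻⁶` for `L ≥ max(31000, 12Z⁴)`. [folklore] -/
private theorem raw_abs_le {L B Z : ℝ} (hL : 31000 ≤ L) (hZL : 12 * Z ^ 4 ≤ L) (hB : 0 ≤ B) :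
    1 / (2 * π) *
        (2 * (Z ^ 2 * (Z ^ 2 * B) *
            (Real.exp (L ^ (1.1 : ℝ)) ^ (1 : ℝ) * rexp (1 ^ 2 / (4 * L ^ 30)) / |(1 : ℝ)|) *
            (gauss (4 * L ^ 30)⁻¹ (L ^ 16) * (Real.sqrt (4 * π * L ^ 30) / 2))) +
          ((L ^ 16 + 5) ^ 3) ^ 2 *
              ((Real.exp (3 / 2) * (Real.exp (L / 2) * (1 + L)) ^ (1 / 10 : ℝ) * (1 + L) *
                  (L ^ 16 + 2)) ^ 2 * B) *
            (Real.exp (L ^ (1.1 : ℝ)) ^ (-1 / 10 : ℝ) * rexp ((-1 / 10) ^ 2 / (4 * L ^ 30)) /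
              |(-1 / 10 : ℝ)|) * Real.sqrt (4 * π * L ^ 30) +
          2 * ((1 - (-1 / 10 : ℝ)) *
            (((L ^ 16 + 5) ^ 3) ^ 2 *
                ((Real.exp (3 / 2) * (Real.exp (L / 2) * (1 + L)) ^ (1 / 10 : ℝ) * (1 + L) *
                      (L ^ 16 + 3) + L + L ^ 16 + 6) ^ 2 * B) *
              (max (Real.exp (L ^ (1.1 : ℝ)) ^ (-1 / 10 : ℝ)) (Real.exp (L ^ (1.1 : ℝ)) ^ (1 : ℝ)) *
                rexp (max ((-1 / 10 : ℝ) ^ 2) ((1 : ℝ) ^ 2) / (4 * L ^ 30)) *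
                gauss (4 * L ^ 30)⁻¹ (L ^ 16) / L ^ 16)))) ≤
      B * (π / L ^ 9 * L ^ 3) := by
  have hL0 : 0 < L := by linarith
  have hL1 : 1 ≤ L := by linarith
  have hT1 : 1 ≤ Real.exp (L ^ (1.1 : ℝ)) := Real.one_le_exp (Real.rpow_nonneg hL0.le _)
  -- kernel-side simplifications
  have e1 : Real.exp (L ^ (1.1 : ℝ)) ^ (1 : ℝ) = Real.exp (L ^ (1.1 : ℝ)) := Real.rpow_one _
  have e2 : Real.exp (L ^ (1.1 : ℝ)) ^ (-1 / 10 : ℝ) = Real.exp (-(L ^ (1.1 : ℝ)) / 10) := by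
    rw [← Real.exp_mul]; congr 1; ring
  have e3 : max (Real.exp (L ^ (1.1 : ℝ)) ^ (-1 / 10 : ℝ)) (Real.exp (L ^ (1.1 : ℝ)) ^ (1 : ℝ)) =
      Real.exp (L ^ (1.1 : ℝ)) := by
    rw [e1]; exact max_eq_right ((Real.rpow_le_one_of_one_le_of_nonpos hT1 (by norm_num)).trans hT1)
  have hΛ1 : (1 : ℝ) ≤ L ^ 30 := one_le_pow₀ hL1
  have e4 : ∀ x : ℝ, x ≤ 1 → rexp (x / (4 * L ^ 30)) ≤ 3 := by
    intro x hx
    have : x / (4 * L ^ 30) ≤ 1 := by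
      rw [div_le_one (by positivity)]; nlinarith
    calc rexp (x / (4 * L ^ 30)) ≤ rexp 1 := Real.exp_le_exp.mpr this
      _ ≤ 3 := by have := Real.exp_one_lt_d9; linarith
  have e5 : Real.sqrt (4 * π * L ^ 30) ≤ 4 * L ^ 15 := by
    rw [show 4 * π * L ^ 30 = (4 * π) * (L ^ 15) ^ 2 by ring, Real.sqrt_mul (by positivity),
      Real.sqrt_sq (by positivity)]
    gcongr
    rw [Real.sqrt_le_left (by norm_num)]
    nlinarith [Real.pi_lt_d2]
  have e6 : gauss (4 * L ^ 30)⁻¹ (L ^ 16) = Real.exp (-(L ^ 2 / 4)) := by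
    rw [gauss]; congr 1; field_simp
  obtain ⟨hX1, hX2, hH⟩ := poly_pieces hL
  rw [e3, e1, e2, e6, abs_one, show |(-1 / 10 : ℝ)| = 1 / 10 by norm_num]
  -- replace every factor by its bound
  have hmax : max ((-1 / 10 : ℝ) ^ 2) ((1 : ℝ) ^ 2) ≤ 1 := by norm_num
  have q1 := piece1_le hL hZL hB
  have q2 := piece2_le hL hB
  have q3 := piece3_le hL hB
  have hπ : 1 / (2 * π) ≤ 1 / 3 := by
    have h3 : (3 : ℝ) ≤ 2 * π := by linarith [Real.pi_gt_three]
    exact one_div_le_one_div_of_le (by norm_num : (0 : ℝ) < 3) h3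
  have hL6 : 0 < L ^ 6 := by positivity
  have hsum : 0 ≤ B / L ^ 6 := div_nonneg hB hL6.le
  have e9 : B * (π / L ^ 9 * L ^ 3) = π * (B / L ^ 6) := by
    have hL9 : L ^ 9 ≠ 0 := pow_ne_zero _ hL0.ne'
    have hL6' : L ^ 6 ≠ 0 := pow_ne_zero _ hL0.ne'
    rw [div_mul_eq_mul_div, mul_div_assoc', mul_div_assoc', div_eq_div_iff hL9 hL6']
    ring
  calc _ ≤ 1 / (2 * π) *
        (2 * (Z ^ 2 * (Z ^ 2 * B) * (Real.exp (L ^ (1.1 : ℝ)) * 3 / 1) *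
            (Real.exp (-(L ^ 2 / 4)) * (4 * L ^ 15 / 2))) +
          ((2 * L ^ 16) ^ 3) ^ 2 * ((64 * L ^ 18 * Real.exp (L / 20)) ^ 2 * B) *
            (Real.exp (-(L ^ (1.1 : ℝ)) / 10) * 3 / (1 / 10)) * (4 * L ^ 15) +
          2 * ((1 - (-1 / 10 : ℝ)) *
            (((2 * L ^ 16) ^ 3) ^ 2 * ((72 * L ^ 18 * Real.exp (L / 20)) ^ 2 * B) *
              (Real.exp (L ^ (1.1 : ℝ)) * 3 * Real.exp (-(L ^ 2 / 4)) / 1)))) := by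
        gcongr
        · exact e4 _ (by norm_num)
        · exact e4 _ (by norm_num)
        · exact e4 _ hmax
        · exact one_le_pow₀ hL1
    _ ≤ 1 / (2 * π) * (B / L ^ 6 + B / L ^ 6 + B / L ^ 6) := by gcongr
    _ ≤ 1 / 3 * (B / L ^ 6 + B / L ^ 6 + B / L ^ 6) := by gcongr
    _ = 1 * (B / L ^ 6) := by ring
    _ ≤ π * (B / L ^ 6) := by gcongr; linarith [Real.pi_gt_three]
    _ = B * (π / L ^ 9 * L ^ 3) := e9.symm


end Absorb

/-! ### The contour shift with the error `B·α𝓛³` -/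

section Final

/-- `√D = e^{𝓛/2}` (`𝓛 = log D`, `D ≥ 1`). [cite: Zhang2022LandauSiegel, §2 (2.1)] -/
private theorem sqrt_eq_exp_ell {D : ℕ} (hD : 1 ≤ D) : Real.sqrt (D : ℝ) = Real.exp (ell D / 2) := by
  have hD0 : (0 : ℝ) < D := by exact_mod_cast hD
  have h : (D : ℝ) = Real.exp (ell D / 2) ^ 2 := by
    rw [← Real.exp_nat_mul, show ((2 : ℕ) : ℝ) * (ell D / 2) = ell D by push_cast; ring, ell,
      Real.exp_log hD0]
  rw [h, Real.sqrt_sq (Real.exp_pos _).le]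

variable {D : ℕ} [NeZero D] (χ : DirichletCharacter ℂ D)

/-- **The contour shift of §15 p. 87** («By Lemma 15.3, we can move the contour of integration in the
same way as in the proof of Lemma 8.4»): for `D ≥ 8` with `𝓛 ≥ 31000` and `𝓛 ≥ 12Z₂⁴`
(`Z₂ = Σ_{n≥1} n⁻²`), `χ` primitive, `Re β = 0`, `|Im β| ≤ 1`, and `U` analytic on `{Re s ≥ 9/10}` with
`‖U(s)‖ ≤ B` there,
`‖(1/2π)∫_ℝ Φ(1+it)T^{1+it}ω₁(1+it)(1+it)⁻¹dt − Res_{s=0}‖ ≤ B·α𝓛³`, `Φ(s) = ζ(1+s)²L(1+s−β,χ)²U(1+s)`,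
the residue in the `dslope` format of the tree's residue theorem (numerator
`φ(z) = ζ₁(1+z)²·(L(1+z−β,χ)²U(1+z))·Tᶻω₁(z)`). [cite: Zhang2022LandauSiegel, §15 p.87] -/
theorem norm_integral_sub_residue_le (hD8 : 8 ≤ D) (hp : χ.IsPrimitive) (hℓ : 31000 ≤ ell D)
    (hℓZ : 12 * (∑' n : ℕ, ‖LSeries.term (1 : ℕ → ℂ) 2 n‖) ^ 4 ≤ ell D)
    {β : ℂ} (hβ : β.re = 0) (hβi : |β.im| ≤ 1) {U : ℂ → ℂ}
    (hU : AnalyticOnNhd ℂ U {s : ℂ | 9 / 10 ≤ s.re}) {B : ℝ} (hB : 0 ≤ B)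
    (hUB : ∀ s : ℂ, 9 / 10 ≤ s.re → ‖U s‖ ≤ B) :
    ‖(1 / (2 * π) : ℂ) * (∫ t : ℝ,
        (riemannZeta (1 + (((1 : ℝ) : ℂ) + t * I)) ^ 2 *
          (χ.LFunction (1 + (((1 : ℝ) : ℂ) + t * I) - β) ^ 2 * U (1 + (((1 : ℝ) : ℂ) + t * I)))) *
        (((bigT D : ℝ) : ℂ) ^ (((1 : ℝ) : ℂ) + t * I) * omega1 (ell D ^ 30) (((1 : ℝ) : ℂ) + t * I) /
          (((1 : ℝ) : ℂ) + t * I))) -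
      (Function.swap dslope (0 : ℂ))^[2]
        (fun z => riemannZeta₁ (1 + z) ^ 2 * (χ.LFunction (1 + z - β) ^ 2 * U (1 + z)) *
          (((bigT D : ℝ) : ℂ) ^ z * omega1 (ell D ^ 30) z)) 0‖ ≤
      B * (alpha D * ell D ^ 3) := by
  have h := norm_integral_sub_residue_le_raw χ hD8 hp (by linarith) hβ hβi hU hB hUB
  rw [sqrt_eq_exp_ell (le_trans (by norm_num) hD8)] at h
  have hα : alpha D = π / ell D ^ 9 := by rw [alpha, bigP, Real.log_exp]
  rw [hα]
  exact h.trans (raw_abs_le (L := ell D) (B := B) (Z := ∑' n : ℕ, ‖LSeries.term (1 : ℕ → ℂ) 2 n‖)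
    hℓ hℓZ hB)

end Final

/-! ### The half-plane growth `e^{2𝓛^{1/10}}` of `U` absorbed into the exponential saving

In `Typed.Section15C.Step15_u055RelS` the bound on `U` over `Re s ≥ 9/10` is `S·e^{2𝓛^{1/10}}`
(RULING 15e); the contour remainder is still `≤ S·α𝓛³`, because the saving `T^{−1/10} = e^{−𝓛^{1.1}/10}`
beats `e^{2𝓛^{1/10}}` as well. -/

section AbsorbGrowth

/-- (C1′): `L²²·e^{2L^{1/10}}·exp(L^{1.1} − L²/4) ≤ 1` for `L ≥ 31000`. [folklore] -/
private theorem absorb_C1' {L : ℝ} (hL : 31000 ≤ L) :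
    L ^ 22 * Real.exp (2 * L ^ (1 / 10 : ℝ)) * Real.exp (L ^ (1.1 : ℝ) - L ^ 2 / 4) ≤ 1 := by
  have hL0 : 0 < L := by linarith
  obtain ⟨hu2, -, h11, hlog, h512⟩ := tenth_root (by linarith : (1024 : ℝ) ≤ L)
  set u := L ^ (1 / 10 : ℝ)
  have hp := pow_le_exp_mul hL0 hlog 22
  calc L ^ 22 * Real.exp (2 * u) * Real.exp (L ^ (1.1 : ℝ) - L ^ 2 / 4)
      ≤ Real.exp (10 * (22 : ℕ) * u) * Real.exp (2 * u) * Real.exp (L ^ (1.1 : ℝ) - L ^ 2 / 4) := by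
        gcongr
    _ = Real.exp (222 * u + L * u - L ^ 2 / 4) := by
        rw [← Real.exp_add, ← Real.exp_add, h11]; congr 1; push_cast; ring
    _ ≤ Real.exp 0 := by
        apply Real.exp_le_exp.mpr
        have h1 : L * u ≤ L ^ 2 / 512 := by nlinarith
        have h2 : 222 * u ≤ L / 2 := by linarith
        nlinarith
    _ = 1 := Real.exp_zero

/-- (C2′): `4·10⁷·L¹⁵³·e^{2L^{1/10}}·exp((L − L^{1.1})/10) ≤ 1` for `L ≥ 31000`. [folklore] -/
private theorem absorb_C2' {L : ℝ} (hL : 31000 ≤ L) :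
    4e7 * L ^ 153 * Real.exp (2 * L ^ (1 / 10 : ℝ)) * Real.exp ((L - L ^ (1.1 : ℝ)) / 10) ≤ 1 := by
  have hL0 : 0 < L := by linarith
  obtain ⟨hu2, -, h11, hlog, -⟩ := tenth_root (by linarith : (1024 : ℝ) ≤ L)
  set u := L ^ (1 / 10 : ℝ)
  have hp := pow_le_exp_mul hL0 hlog 153
  have hc : (4e7 : ℝ) ≤ Real.exp 18 := by
    have h1 : (2.7 : ℝ) ≤ Real.exp 1 := by
      have := Real.exp_one_gt_d9; linarith
    have h2 : (2.7 : ℝ) ^ 18 ≤ Real.exp 1 ^ 18 := pow_le_pow_left₀ (by norm_num) h1 18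
    rw [← Real.exp_nat_mul] at h2
    norm_num at h2
    have h3 : (4e7 : ℝ) ≤ (2.7 : ℝ) ^ 18 := by norm_num
    linarith
  calc 4e7 * L ^ 153 * Real.exp (2 * u) * Real.exp ((L - L ^ (1.1 : ℝ)) / 10)
      ≤ Real.exp 18 * Real.exp (10 * (153 : ℕ) * u) * Real.exp (2 * u) *
          Real.exp ((L - L ^ (1.1 : ℝ)) / 10) := by gcongr
    _ = Real.exp (18 + 1532 * u + (L - L * u) / 10) := by
        rw [← Real.exp_add, ← Real.exp_add, ← Real.exp_add, h11]; congr 1; push_cast; ring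
    _ ≤ Real.exp 0 := by
        apply Real.exp_le_exp.mpr
        have h1 : (L - L * u) / 10 ≤ -(L * u) / 20 := by nlinarith
        have h2 : 18 ≤ 9 * u := by linarith
        have h3 : 1541 * u ≤ L * u / 20 := by nlinarith
        nlinarith
    _ = 1 := Real.exp_zero

/-- (C3′): `3·10⁶·L¹³⁸·e^{2L^{1/10}}·exp(L/10 + L^{1.1} − L²/4) ≤ 1` for `L ≥ 31000`. [folklore] -/
private theorem absorb_C3' {L : ℝ} (hL : 31000 ≤ L) :
    3e6 * L ^ 138 * Real.exp (2 * L ^ (1 / 10 : ℝ)) * Real.exp (L / 10 + L ^ (1.1 : ℝ) - L ^ 2 / 4) ≤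
      1 := by
  have hL0 : 0 < L := by linarith
  obtain ⟨hu2, -, h11, hlog, h512⟩ := tenth_root (by linarith : (1024 : ℝ) ≤ L)
  set u := L ^ (1 / 10 : ℝ)
  have hp := pow_le_exp_mul hL0 hlog 138
  have hc : (3e6 : ℝ) ≤ Real.exp 16 := by
    have h1 : (2.7 : ℝ) ≤ Real.exp 1 := by
      have := Real.exp_one_gt_d9; linarith
    have h2 : (2.7 : ℝ) ^ 16 ≤ Real.exp 1 ^ 16 := pow_le_pow_left₀ (by norm_num) h1 16
    rw [← Real.exp_nat_mul] at h2
    norm_num at h2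
    have h3 : (3e6 : ℝ) ≤ (2.7 : ℝ) ^ 16 := by norm_num
    linarith
  calc 3e6 * L ^ 138 * Real.exp (2 * u) * Real.exp (L / 10 + L ^ (1.1 : ℝ) - L ^ 2 / 4)
      ≤ Real.exp 16 * Real.exp (10 * (138 : ℕ) * u) * Real.exp (2 * u) *
          Real.exp (L / 10 + L ^ (1.1 : ℝ) - L ^ 2 / 4) := by gcongr
    _ = Real.exp (16 + 1382 * u + L / 10 + L * u - L ^ 2 / 4) := by
        rw [← Real.exp_add, ← Real.exp_add, ← Real.exp_add, h11]; congr 1; push_cast; ring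
    _ ≤ Real.exp 0 := by
        apply Real.exp_le_exp.mpr
        have h1 : L * u ≤ L ^ 2 / 512 := by nlinarith
        have h2 : 16 ≤ 8 * u := by linarith
        have h3 : 1390 * u ≤ 3 * L := by linarith
        nlinarith
    _ = 1 := Real.exp_zero

/-- Piece 1 with the growth factor: `B = S·e^{2L^{1/10}}` gives `≤ S/L⁶`. [folklore] -/
private theorem piece1_le' {L S Z : ℝ} (hL : 31000 ≤ L) (hZL : 12 * Z ^ 4 ≤ L) (hS : 0 ≤ S) :
    2 * (Z ^ 2 * (Z ^ 2 * (S * Real.exp (2 * L ^ (1 / 10 : ℝ)))) * (Real.exp (L ^ (1.1 : ℝ)) * 3 / 1) *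
        (Real.exp (-(L ^ 2 / 4)) * (4 * L ^ 15 / 2))) ≤ S / L ^ 6 := by
  have hL0 : 0 < L := by linarith
  have hL6 : 0 < L ^ 6 := by positivity
  have hC1 := absorb_C1' hL
  have hexp1 : Real.exp (L ^ (1.1 : ℝ)) * Real.exp (-(L ^ 2 / 4)) = Real.exp (L ^ (1.1 : ℝ) - L ^ 2 / 4) := by
    rw [← Real.exp_add]; ring_nf
  have e : 2 * (Z ^ 2 * (Z ^ 2 * (S * Real.exp (2 * L ^ (1 / 10 : ℝ)))) *
      (Real.exp (L ^ (1.1 : ℝ)) * 3 / 1) * (Real.exp (-(L ^ 2 / 4)) * (4 * L ^ 15 / 2))) =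
      S * ((12 * Z ^ 4) * L ^ 15 * Real.exp (2 * L ^ (1 / 10 : ℝ)) *
        (Real.exp (L ^ (1.1 : ℝ)) * Real.exp (-(L ^ 2 / 4)))) := by ring
  rw [e, hexp1]
  have h1 : (12 * Z ^ 4) * L ^ 15 * Real.exp (2 * L ^ (1 / 10 : ℝ)) *
      Real.exp (L ^ (1.1 : ℝ) - L ^ 2 / 4) ≤ 1 / L ^ 6 := by
    rw [le_div_iff₀ hL6]
    calc 12 * Z ^ 4 * L ^ 15 * Real.exp (2 * L ^ (1 / 10 : ℝ)) * Real.exp (L ^ (1.1 : ℝ) - L ^ 2 / 4) * L ^ 6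
        = (12 * Z ^ 4) * (L ^ 21 * Real.exp (2 * L ^ (1 / 10 : ℝ)) * Real.exp (L ^ (1.1 : ℝ) - L ^ 2 / 4)) := by
          ring
      _ ≤ L * (L ^ 21 * Real.exp (2 * L ^ (1 / 10 : ℝ)) * Real.exp (L ^ (1.1 : ℝ) - L ^ 2 / 4)) := by
          gcongr
      _ = L ^ 22 * Real.exp (2 * L ^ (1 / 10 : ℝ)) * Real.exp (L ^ (1.1 : ℝ) - L ^ 2 / 4) := by ring
      _ ≤ 1 := hC1
  calc S * (12 * Z ^ 4 * L ^ 15 * Real.exp (2 * L ^ (1 / 10 : ℝ)) * Real.exp (L ^ (1.1 : ℝ) - L ^ 2 / 4))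
      ≤ S * (1 / L ^ 6) := mul_le_mul_of_nonneg_left h1 hS
    _ = S / L ^ 6 := by ring

/-- Piece 2 with the growth factor. [folklore] -/
private theorem piece2_le' {L S : ℝ} (hL : 31000 ≤ L) (hS : 0 ≤ S) :
    ((2 * L ^ 16) ^ 3) ^ 2 * ((64 * L ^ 18 * Real.exp (L / 20)) ^ 2 * (S * Real.exp (2 * L ^ (1 / 10 : ℝ)))) *
        (Real.exp (-(L ^ (1.1 : ℝ)) / 10) * 3 / (1 / 10)) * (4 * L ^ 15) ≤ S / L ^ 6 := by
  have hL0 : 0 < L := by linarith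
  have hL6 : 0 < L ^ 6 := by positivity
  have hC2 := absorb_C2' hL
  have hexp2 : Real.exp (L / 20) ^ 2 * Real.exp (-(L ^ (1.1 : ℝ)) / 10) =
      Real.exp ((L - L ^ (1.1 : ℝ)) / 10) := by
    rw [← Real.exp_nat_mul, ← Real.exp_add]; congr 1; push_cast; ring
  have e : ((2 * L ^ 16) ^ 3) ^ 2 *
      ((64 * L ^ 18 * Real.exp (L / 20)) ^ 2 * (S * Real.exp (2 * L ^ (1 / 10 : ℝ)))) *
      (Real.exp (-(L ^ (1.1 : ℝ)) / 10) * 3 / (1 / 10)) * (4 * L ^ 15) =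
      S * (31457280 * L ^ 147 * Real.exp (2 * L ^ (1 / 10 : ℝ)) *
        (Real.exp (L / 20) ^ 2 * Real.exp (-(L ^ (1.1 : ℝ)) / 10))) := by ring
  rw [e, hexp2]
  have h1 : 31457280 * L ^ 147 * Real.exp (2 * L ^ (1 / 10 : ℝ)) *
      Real.exp ((L - L ^ (1.1 : ℝ)) / 10) ≤ 1 / L ^ 6 := by
    rw [le_div_iff₀ hL6]
    calc 31457280 * L ^ 147 * Real.exp (2 * L ^ (1 / 10 : ℝ)) * Real.exp ((L - L ^ (1.1 : ℝ)) / 10) * L ^ 6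
        = 31457280 * (L ^ 153 * Real.exp (2 * L ^ (1 / 10 : ℝ)) * Real.exp ((L - L ^ (1.1 : ℝ)) / 10)) := by
          ring
      _ ≤ 4e7 * (L ^ 153 * Real.exp (2 * L ^ (1 / 10 : ℝ)) * Real.exp ((L - L ^ (1.1 : ℝ)) / 10)) := by
          gcongr; norm_num
      _ = 4e7 * L ^ 153 * Real.exp (2 * L ^ (1 / 10 : ℝ)) * Real.exp ((L - L ^ (1.1 : ℝ)) / 10) := by ring
      _ ≤ 1 := hC2
  calc S * (31457280 * L ^ 147 * Real.exp (2 * L ^ (1 / 10 : ℝ)) * Real.exp ((L - L ^ (1.1 : ℝ)) / 10))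
      ≤ S * (1 / L ^ 6) := mul_le_mul_of_nonneg_left h1 hS
    _ = S / L ^ 6 := by ring

/-- Piece 3 with the growth factor. [folklore] -/
private theorem piece3_le' {L S : ℝ} (hL : 31000 ≤ L) (hS : 0 ≤ S) :
    2 * ((1 - (-1 / 10 : ℝ)) *
        (((2 * L ^ 16) ^ 3) ^ 2 *
            ((72 * L ^ 18 * Real.exp (L / 20)) ^ 2 * (S * Real.exp (2 * L ^ (1 / 10 : ℝ)))) *
          (Real.exp (L ^ (1.1 : ℝ)) * 3 * Real.exp (-(L ^ 2 / 4)) / 1))) ≤ S / L ^ 6 := by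
  have hL0 : 0 < L := by linarith
  have hL6 : 0 < L ^ 6 := by positivity
  have hC3 := absorb_C3' hL
  have hexp3 : Real.exp (L / 20) ^ 2 * (Real.exp (L ^ (1.1 : ℝ)) * Real.exp (-(L ^ 2 / 4))) =
      Real.exp (L / 10 + L ^ (1.1 : ℝ) - L ^ 2 / 4) := by
    rw [← Real.exp_nat_mul, ← Real.exp_add, ← Real.exp_add]; congr 1; push_cast; ring
  have e : 2 * ((1 - (-1 / 10 : ℝ)) *
      (((2 * L ^ 16) ^ 3) ^ 2 *
          ((72 * L ^ 18 * Real.exp (L / 20)) ^ 2 * (S * Real.exp (2 * L ^ (1 / 10 : ℝ)))) *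
        (Real.exp (L ^ (1.1 : ℝ)) * 3 * Real.exp (-(L ^ 2 / 4)) / 1))) =
      S * ((10948608 / 5) * L ^ 132 * Real.exp (2 * L ^ (1 / 10 : ℝ)) *
        (Real.exp (L / 20) ^ 2 * (Real.exp (L ^ (1.1 : ℝ)) * Real.exp (-(L ^ 2 / 4))))) := by ring
  rw [e, hexp3]
  have h1 : (10948608 / 5) * L ^ 132 * Real.exp (2 * L ^ (1 / 10 : ℝ)) *
      Real.exp (L / 10 + L ^ (1.1 : ℝ) - L ^ 2 / 4) ≤ 1 / L ^ 6 := by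
    rw [le_div_iff₀ hL6]
    calc (10948608 / 5) * L ^ 132 * Real.exp (2 * L ^ (1 / 10 : ℝ)) *
          Real.exp (L / 10 + L ^ (1.1 : ℝ) - L ^ 2 / 4) * L ^ 6
        = (10948608 / 5) * (L ^ 138 * Real.exp (2 * L ^ (1 / 10 : ℝ)) *
            Real.exp (L / 10 + L ^ (1.1 : ℝ) - L ^ 2 / 4)) := by ring
      _ ≤ 3e6 * (L ^ 138 * Real.exp (2 * L ^ (1 / 10 : ℝ)) *
            Real.exp (L / 10 + L ^ (1.1 : ℝ) - L ^ 2 / 4)) := by gcongr; norm_num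
      _ = 3e6 * L ^ 138 * Real.exp (2 * L ^ (1 / 10 : ℝ)) *
            Real.exp (L / 10 + L ^ (1.1 : ℝ) - L ^ 2 / 4) := by ring
      _ ≤ 1 := hC3
  calc S * ((10948608 / 5) * L ^ 132 * Real.exp (2 * L ^ (1 / 10 : ℝ)) *
        Real.exp (L / 10 + L ^ (1.1 : ℝ) - L ^ 2 / 4)) ≤ S * (1 / L ^ 6) := mul_le_mul_of_nonneg_left h1 hS
    _ = S / L ^ 6 := by ring

/-- The raw three-piece bound with `B = S·e^{2L^{1/10}}` is still `≤ S·π·L⁻⁶`. [folklore] -/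
private theorem raw_abs_le' {L S Z : ℝ} (hL : 31000 ≤ L) (hZL : 12 * Z ^ 4 ≤ L) (hS : 0 ≤ S) :
    1 / (2 * π) *
        (2 * (Z ^ 2 * (Z ^ 2 * (S * Real.exp (2 * L ^ (1 / 10 : ℝ)))) *
            (Real.exp (L ^ (1.1 : ℝ)) ^ (1 : ℝ) * rexp (1 ^ 2 / (4 * L ^ 30)) / |(1 : ℝ)|) *
            (gauss (4 * L ^ 30)⁻¹ (L ^ 16) * (Real.sqrt (4 * π * L ^ 30) / 2))) +
          ((L ^ 16 + 5) ^ 3) ^ 2 *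
              ((Real.exp (3 / 2) * (Real.exp (L / 2) * (1 + L)) ^ (1 / 10 : ℝ) * (1 + L) *
                  (L ^ 16 + 2)) ^ 2 * (S * Real.exp (2 * L ^ (1 / 10 : ℝ)))) *
            (Real.exp (L ^ (1.1 : ℝ)) ^ (-1 / 10 : ℝ) * rexp ((-1 / 10) ^ 2 / (4 * L ^ 30)) /
              |(-1 / 10 : ℝ)|) * Real.sqrt (4 * π * L ^ 30) +
          2 * ((1 - (-1 / 10 : ℝ)) *
            (((L ^ 16 + 5) ^ 3) ^ 2 *
                ((Real.exp (3 / 2) * (Real.exp (L / 2) * (1 + L)) ^ (1 / 10 : ℝ) * (1 + L) *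
                      (L ^ 16 + 3) + L + L ^ 16 + 6) ^ 2 * (S * Real.exp (2 * L ^ (1 / 10 : ℝ)))) *
              (max (Real.exp (L ^ (1.1 : ℝ)) ^ (-1 / 10 : ℝ)) (Real.exp (L ^ (1.1 : ℝ)) ^ (1 : ℝ)) *
                rexp (max ((-1 / 10 : ℝ) ^ 2) ((1 : ℝ) ^ 2) / (4 * L ^ 30)) *
                gauss (4 * L ^ 30)⁻¹ (L ^ 16) / L ^ 16)))) ≤
      S * (π / L ^ 9 * L ^ 3) := by
  have hL0 : 0 < L := by linarith
  have hL1 : 1 ≤ L := by linarith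
  have hE0 : 0 ≤ S * Real.exp (2 * L ^ (1 / 10 : ℝ)) := by positivity
  have hT1 : 1 ≤ Real.exp (L ^ (1.1 : ℝ)) := Real.one_le_exp (Real.rpow_nonneg hL0.le _)
  have e1 : Real.exp (L ^ (1.1 : ℝ)) ^ (1 : ℝ) = Real.exp (L ^ (1.1 : ℝ)) := Real.rpow_one _
  have e2 : Real.exp (L ^ (1.1 : ℝ)) ^ (-1 / 10 : ℝ) = Real.exp (-(L ^ (1.1 : ℝ)) / 10) := by
    rw [← Real.exp_mul]; congr 1; ring
  have e3 : max (Real.exp (L ^ (1.1 : ℝ)) ^ (-1 / 10 : ℝ)) (Real.exp (L ^ (1.1 : ℝ)) ^ (1 : ℝ)) =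
      Real.exp (L ^ (1.1 : ℝ)) := by
    rw [e1]; exact max_eq_right ((Real.rpow_le_one_of_one_le_of_nonpos hT1 (by norm_num)).trans hT1)
  have hΛ1 : (1 : ℝ) ≤ L ^ 30 := one_le_pow₀ hL1
  have e4 : ∀ x : ℝ, x ≤ 1 → rexp (x / (4 * L ^ 30)) ≤ 3 := by
    intro x hx
    have : x / (4 * L ^ 30) ≤ 1 := by
      rw [div_le_one (by positivity)]; nlinarith
    calc rexp (x / (4 * L ^ 30)) ≤ rexp 1 := Real.exp_le_exp.mpr this
      _ ≤ 3 := by have := Real.exp_one_lt_d9; linarith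
  have e5 : Real.sqrt (4 * π * L ^ 30) ≤ 4 * L ^ 15 := by
    rw [show 4 * π * L ^ 30 = (4 * π) * (L ^ 15) ^ 2 by ring, Real.sqrt_mul (by positivity),
      Real.sqrt_sq (by positivity)]
    gcongr
    rw [Real.sqrt_le_left (by norm_num)]
    nlinarith [Real.pi_lt_d2]
  have e6 : gauss (4 * L ^ 30)⁻¹ (L ^ 16) = Real.exp (-(L ^ 2 / 4)) := by
    rw [gauss]; congr 1; field_simp
  obtain ⟨hX1, hX2, hH⟩ := poly_pieces hL
  rw [e3, e1, e2, e6, abs_one, show |(-1 / 10 : ℝ)| = 1 / 10 by norm_num]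
  have hmax : max ((-1 / 10 : ℝ) ^ 2) ((1 : ℝ) ^ 2) ≤ 1 := by norm_num
  have q1 := piece1_le' hL hZL hS
  have q2 := piece2_le' hL hS
  have q3 := piece3_le' hL hS
  have hπ : 1 / (2 * π) ≤ 1 / 3 := by
    have h3 : (3 : ℝ) ≤ 2 * π := by linarith [Real.pi_gt_three]
    exact one_div_le_one_div_of_le (by norm_num : (0 : ℝ) < 3) h3
  have hL6 : 0 < L ^ 6 := by positivity
  have hsum : 0 ≤ S / L ^ 6 := div_nonneg hS hL6.le
  have e9 : S * (π / L ^ 9 * L ^ 3) = π * (S / L ^ 6) := by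
    have hL9 : L ^ 9 ≠ 0 := pow_ne_zero _ hL0.ne'
    have hL6' : L ^ 6 ≠ 0 := pow_ne_zero _ hL0.ne'
    rw [div_mul_eq_mul_div, mul_div_assoc', mul_div_assoc', div_eq_div_iff hL9 hL6']
    ring
  calc _ ≤ 1 / (2 * π) *
        (2 * (Z ^ 2 * (Z ^ 2 * (S * Real.exp (2 * L ^ (1 / 10 : ℝ)))) *
            (Real.exp (L ^ (1.1 : ℝ)) * 3 / 1) * (Real.exp (-(L ^ 2 / 4)) * (4 * L ^ 15 / 2))) +
          ((2 * L ^ 16) ^ 3) ^ 2 *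
              ((64 * L ^ 18 * Real.exp (L / 20)) ^ 2 * (S * Real.exp (2 * L ^ (1 / 10 : ℝ)))) *
            (Real.exp (-(L ^ (1.1 : ℝ)) / 10) * 3 / (1 / 10)) * (4 * L ^ 15) +
          2 * ((1 - (-1 / 10 : ℝ)) *
            (((2 * L ^ 16) ^ 3) ^ 2 *
                ((72 * L ^ 18 * Real.exp (L / 20)) ^ 2 * (S * Real.exp (2 * L ^ (1 / 10 : ℝ)))) *
              (Real.exp (L ^ (1.1 : ℝ)) * 3 * Real.exp (-(L ^ 2 / 4)) / 1)))) := by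
        gcongr
        · exact e4 _ (by norm_num)
        · exact e4 _ (by norm_num)
        · exact e4 _ hmax
        · exact one_le_pow₀ hL1
    _ ≤ 1 / (2 * π) * (S / L ^ 6 + S / L ^ 6 + S / L ^ 6) := by gcongr
    _ ≤ 1 / 3 * (S / L ^ 6 + S / L ^ 6 + S / L ^ 6) := by gcongr
    _ = 1 * (S / L ^ 6) := by ring
    _ ≤ π * (S / L ^ 6) := by gcongr; linarith [Real.pi_gt_three]
    _ = S * (π / L ^ 9 * L ^ 3) := e9.symm

end AbsorbGrowth

section FinalGrowth

variable {D : ℕ} [NeZero D] (χ : DirichletCharacter ℂ D)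

/-- **The contour shift of §15 p. 87 with the RULING-15e growth of `U`**: as
`norm_integral_sub_residue_le`, but with the half-plane bound `‖U(s)‖ ≤ S·e^{2𝓛^{1/10}}` on
`Re s ≥ 9/10` (Lemma 15.3, reading `Lemma153Rp`) the remainder is still `≤ S·α𝓛³` — the shape consumed
by `Typed.Section15C.Step15_u055RelS`. [cite: Zhang2022LandauSiegel, §15 p.87] -/
theorem norm_integral_sub_residue_le_growth (hD8 : 8 ≤ D) (hp : χ.IsPrimitive) (hℓ : 31000 ≤ ell D)
    (hℓZ : 12 * (∑' n : ℕ, ‖LSeries.term (1 : ℕ → ℂ) 2 n‖) ^ 4 ≤ ell D)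
    {β : ℂ} (hβ : β.re = 0) (hβi : |β.im| ≤ 1) {U : ℂ → ℂ}
    (hU : AnalyticOnNhd ℂ U {s : ℂ | 9 / 10 ≤ s.re}) {S : ℝ} (hS : 0 ≤ S)
    (hUB : ∀ s : ℂ, 9 / 10 ≤ s.re → ‖U s‖ ≤ S * Real.exp (2 * ell D ^ (1 / 10 : ℝ))) :
    ‖(1 / (2 * π) : ℂ) * (∫ t : ℝ,
        (riemannZeta (1 + (((1 : ℝ) : ℂ) + t * I)) ^ 2 *
          (χ.LFunction (1 + (((1 : ℝ) : ℂ) + t * I) - β) ^ 2 * U (1 + (((1 : ℝ) : ℂ) + t * I)))) *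
        (((bigT D : ℝ) : ℂ) ^ (((1 : ℝ) : ℂ) + t * I) * omega1 (ell D ^ 30) (((1 : ℝ) : ℂ) + t * I) /
          (((1 : ℝ) : ℂ) + t * I))) -
      (Function.swap dslope (0 : ℂ))^[2]
        (fun z => riemannZeta₁ (1 + z) ^ 2 * (χ.LFunction (1 + z - β) ^ 2 * U (1 + z)) *
          (((bigT D : ℝ) : ℂ) ^ z * omega1 (ell D ^ 30) z)) 0‖ ≤
      S * (alpha D * ell D ^ 3) := by
  have hB : 0 ≤ S * Real.exp (2 * ell D ^ (1 / 10 : ℝ)) := by positivity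
  have h := norm_integral_sub_residue_le_raw χ hD8 hp (by linarith) hβ hβi hU hB hUB
  rw [sqrt_eq_exp_ell (le_trans (by norm_num) hD8)] at h
  have hα : alpha D = π / ell D ^ 9 := by rw [alpha, bigP, Real.log_exp]
  rw [hα]
  exact h.trans (raw_abs_le' (L := ell D) (S := S) (Z := ∑' n : ℕ, ‖LSeries.term (1 : ℕ → ℂ) 2 n‖)
    hℓ hℓZ hS)

end FinalGrowth

end Literature.NumberTheory.LFunctions.Zhang2022.U055
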